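import Summits.ValiantsHypothesis.ValiantsHypothesis.Theorems.DepthWindowNodeBias
import Summits.ValiantsHypothesis.ValiantsHypothesis.Theorems.DepthWindowTreeBiasRung

/-!
# Route `DepthWindow` — tree bias: padding monotonicity, the `ℓ¹` ceiling, and the collapse of symmetric words

Cone-free helper (decomp-valiant lens 4, g13) supporting the crux item `HomImmHardTwoOne`
(stmt-ValiantsHypothesis-30635): the three structural lemmas on the typed tree bias of
`DepthWindowTreeBiasBridge.lean` asked for by the workshop critic (bus 610 (ii), 632) and listed in the lens-6
record note QTB-ORDERED-SIBLING-NOTE-g15 §3(c):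

* `treeBiasGe_anti_depth` — PADDING: `Treebias` is antitone in the depth (`1 ≤ Δ' ≤ Δ`,
  `TreeBiasGe w Δ τ → TreeBiasGe w Δ' τ`): a depth-`Δ'` tree frozen from level `Δ'` on (`LTree.pad`) is a
  depth-`Δ` tree with the same internal paths below `Δ'` and bias-`0` unary paths above (LST 2022 Def. 2: trees of
  depth AT MOST `Δ`; the levelled encoding represents them by padding);
* `treeBiasGe_le` — the `ℓ¹` CEILING `Treebias_Δ(W) ≤ ‖W‖₁ - |Sum W|` for every `Δ ≥ 1` (padded star; with
  `treeBiasGe_one_iff` of `DepthWindowTreeBiasRung`);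
* `treeBiasGe_symm_le` — SYMMETRIC WORDS COLLAPSE: if the letters are matched by a fixed-point-free involution
  `σ` with `w (σ i) = -w i`, then `Treebias_Δ(W) ≤ 2·max |wᵢ|` for every `Δ ≥ 2` (the pair tree
  `{i, σ i}`-blocks-then-root has all block sums `0`).  The explicit words of Tavenas–Limaye–Srinivasan (STOC 2022,
  eq. (5)) behind the non-commutative / ordered sibling of `HomImmHardAt` are symmetric, so — as a kernel fact —
  they carry NO commutative tree bias: the gap between the decided ordered sibling and the open leaf
  `TreeBiasGrowth` is exactly the builder's freedom to use non-contiguous blocks (LST 2022 p. 12).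

References: [LimayeSrinivasanTavenas2022] CCC 2022 (LIPIcs 234:32) Def. 2 and the remark after it, Thm. 3, §1.3
(p. 12); [TavenasLimayeSrinivasan2022] STOC 2022, Thm. 4, Prop. 15, eq. (5).
-/

-- layout Summits/ValiantsHypothesis/ValiantsHypothesis forces the duplicated namespace component
set_option linter.dupNamespace false

namespace Summit.ValiantsHypothesis.ValiantsHypothesis.Theorems.DepthWindow.TreeBias

open Finset

variable {d : ℕ}

/-! ### Padding: freeze a tree from level `Δ'` on -/

/-- The tree `T` frozen from level `Δ'` upwards: level `t` of `T.pad Δ'` is level `min t Δ'` of `T` (unary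
nodes above `Δ'`). [cite: LimayeSrinivasanTavenas2022, Def. 2] -/
def LTree.pad (T : LTree d) (Δ' : ℕ) : LTree d where
  lab t i := T.lab (min t Δ') i
  leaf i := by simp [T.leaf]
  refine t i j h := by
    by_cases ht : t + 1 ≤ Δ'
    · rw [min_eq_left (by omega : t ≤ Δ')] at h
      rw [min_eq_left ht]
      exact T.refine t i j h
    · rwa [show min (t + 1) Δ' = min t Δ' by omega]

/-- Below the freezing level the padded tree is the tree. [folklore] -/
theorem LTree.pad_lab_of_le (T : LTree d) {Δ' t : ℕ} (h : t ≤ Δ') : (T.pad Δ').lab t = T.lab t := by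
  funext i; simp [LTree.pad, min_eq_left h]

/-- From the freezing level on the padded tree repeats level `Δ'`. [folklore] -/
theorem LTree.pad_lab_of_ge (T : LTree d) {Δ' t : ℕ} (h : Δ' ≤ t) : (T.pad Δ').lab t = T.lab Δ' := by
  funext i; simp [LTree.pad, min_eq_right h]

/-- Block sums below the freezing level are unchanged. [folklore] -/
theorem blockSum_pad_of_le (w : Fin d → ℤ) (T : LTree d) {Δ' t : ℕ} (h : t ≤ Δ') (l : Fin d) :
    blockSum w (T.pad Δ') t l = blockSum w T t l := by
  unfold blockSum; rw [T.pad_lab_of_le h]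

/-- In the padded tree the levels above `Δ'` contribute nothing to the off-path cost of a path ending at a
level `t ≤ Δ'` (their only child is on the path), so the cost is that of the same path in `T`.
[cite: LimayeSrinivasanTavenas2022, Def. 2] -/
theorem offCost_pad (w : Fin d → ℤ) (T : LTree d) {Δ' Δ t : ℕ} (hroot : ∀ i j, T.lab Δ' i = T.lab Δ' j)
    (ht : t ≤ Δ') (hle : Δ' ≤ Δ) (i : Fin d) :
    offCost w (T.pad Δ') Δ t i = offCost w T Δ' t i := by
  unfold offCost
  have hsplit : Icc t Δ = Icc t Δ' ∪ Ioc Δ' Δ := by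
    rw [← coe_inj, coe_union, coe_Icc, coe_Icc, coe_Ioc, Set.Icc_union_Ioc_eq_Icc ht hle]
  rw [hsplit, sum_union (disjoint_left.2 fun u hu hu' => by
        rw [mem_Icc] at hu; rw [mem_Ioc] at hu'; omega)]
  have hzero : ∑ u ∈ Ioc Δ' Δ, ∑ l ∈ (((univ.filter fun j => (T.pad Δ').lab u j = (T.pad Δ').lab u i).image
      ((T.pad Δ').lab (u - 1))).filter fun l => u = t ∨ l ≠ (T.pad Δ').lab (u - 1) i),
        |blockSum w (T.pad Δ') (u - 1) l| = 0 := by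
    refine sum_eq_zero fun u hu => ?_
    rw [mem_Ioc] at hu
    refine sum_eq_zero fun l hl => ?_
    exfalso
    rw [mem_filter, mem_image] at hl
    obtain ⟨⟨j, _, hj⟩, hl2⟩ := hl
    rw [T.pad_lab_of_ge (by omega : Δ' ≤ u - 1)] at hj hl2
    rcases hl2 with h | h
    · omega
    · exact h (by rw [← hj]; exact hroot j i)
  rw [hzero, add_zero]
  refine sum_congr rfl fun u hu => ?_
  rw [mem_Icc] at hu
  rw [T.pad_lab_of_le hu.2, T.pad_lab_of_le (by omega : u - 1 ≤ Δ')]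
  simp only [blockSum_pad_of_le w T (by omega : u - 1 ≤ Δ')]

/-- A path of the padded tree ending in the unary padding (level `t > Δ'`) has off-path cost `|Sum W|`, i.e.
bias `0`. [cite: LimayeSrinivasanTavenas2022, Def. 2] -/
theorem offCost_pad_high (w : Fin d → ℤ) (T : LTree d) {Δ' Δ t : ℕ} (hroot : ∀ i j, T.lab Δ' i = T.lab Δ' j)
    (ht : Δ' < t) (htΔ : t ≤ Δ) (i : Fin d) :
    offCost w (T.pad Δ') Δ t i = |∑ j, w j| := by
  unfold offCost
  rw [Icc_eq_cons_Ioc htΔ, sum_cons]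
  have hzero : ∑ u ∈ Ioc t Δ, ∑ l ∈ (((univ.filter fun j => (T.pad Δ').lab u j = (T.pad Δ').lab u i).image
      ((T.pad Δ').lab (u - 1))).filter fun l => u = t ∨ l ≠ (T.pad Δ').lab (u - 1) i),
        |blockSum w (T.pad Δ') (u - 1) l| = 0 := by
    refine sum_eq_zero fun u hu => ?_
    rw [mem_Ioc] at hu
    refine sum_eq_zero fun l hl => ?_
    exfalso
    rw [mem_filter, mem_image] at hl
    obtain ⟨⟨j, _, hj⟩, hl2⟩ := hl
    rw [T.pad_lab_of_ge (by omega : Δ' ≤ u - 1)] at hj hl2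
    rcases hl2 with h | h
    · omega
    · exact h (by rw [← hj]; exact hroot j i)
  rw [hzero, add_zero]
  have hblk : (univ.filter fun j => (T.pad Δ').lab t j = (T.pad Δ').lab t i) = univ := by
    apply filter_true_of_mem
    intro j _
    rw [T.pad_lab_of_ge ht.le]
    exact hroot j i
  have himg : (univ : Finset (Fin d)).image ((T.pad Δ').lab (t - 1)) = {T.lab Δ' i} := by
    ext l
    rw [mem_image, mem_singleton, T.pad_lab_of_ge (by omega : Δ' ≤ t - 1)]
    constructor
    · rintro ⟨j, _, rfl⟩; exact hroot j i
    · intro h; exact ⟨i, mem_univ _, h.symm⟩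
  rw [hblk, himg, filter_true_of_mem (fun l _ => Or.inl rfl), sum_singleton]
  unfold blockSum
  rw [T.pad_lab_of_ge (by omega : Δ' ≤ t - 1), filter_true_of_mem (fun j _ => hroot j i)]

/-- The children of a single-block level have total `|Sum|` at least `|Sum W|`: `|Σ w| ≤ nodeBias` at the root.
[folklore] -/
theorem abs_sum_le_nodeBias_root (w : Fin d → ℤ) (T : LTree d) {Δ : ℕ} (hroot : ∀ i j, T.lab Δ i = T.lab Δ j)
    (i : Fin d) : |∑ j, w j| ≤ nodeBias w T Δ i := by
  unfold nodeBias
  rw [filter_true_of_mem (fun j _ => hroot j i)]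
  have hpart : ∑ l ∈ (univ : Finset (Fin d)).image (T.lab (Δ - 1)), blockSum w T (Δ - 1) l = ∑ j, w j := by
    unfold blockSum
    exact sum_fiberwise_of_maps_to (fun j hj => mem_image_of_mem _ hj) _
  rw [← hpart]
  exact abs_sum_le_sum_abs _ _

/-- **Tree bias is antitone in the depth** (padding): for `1 ≤ Δ' ≤ Δ`, `Treebias_Δ(W) ≥ τ ⇒ Treebias_{Δ'}(W) ≥ τ`
— every depth-`Δ'` tree, padded, is a depth-`Δ` tree with the same path biases below `Δ'` and bias `0` above.
(LST 2022 Def. 2 takes trees of depth at most `Δ`; this is the levelled encoding's form of that convention.)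
[cite: LimayeSrinivasanTavenas2022, Def. 2] -/
theorem treeBiasGe_anti_depth {w : Fin d → ℤ} {Δ' Δ τ : ℕ} (h1 : 1 ≤ Δ') (hle : Δ' ≤ Δ)
    (h : TreeBiasGe w Δ τ) : TreeBiasGe w Δ' τ := by
  intro T hroot
  have hrootpad : ∀ i j, (T.pad Δ').lab Δ i = (T.pad Δ').lab Δ j := fun i j => by
    rw [T.pad_lab_of_ge hle]; exact hroot i j
  obtain ⟨t, i, ht1, htΔ, hτ⟩ := h (T.pad Δ') hrootpad
  rcases le_or_gt t Δ' with ht | ht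
  · exact ⟨t, i, ht1, ht, by rwa [offCost_pad w T hroot ht hle] at hτ⟩
  · rw [offCost_pad_high w T hroot ht htΔ, sub_self] at hτ
    refine ⟨Δ', i, h1, le_rfl, ?_⟩
    have hnb := nodeBias_le_offCost w T (le_refl Δ') i
    have hrs := abs_sum_le_nodeBias_root w T hroot i
    linarith

/-! ### The `ℓ¹` ceiling -/

/-- **`Treebias_Δ(W) ≤ ‖W‖₁ - |Sum W|`** for every `Δ ≥ 1` (antitonicity down to depth `1` and the closed form
`treeBiasGe_one_iff` of the star).  In particular the tree bias of a word fitting `IMM_{n,d}` never exceeds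
`2d·⌊log₂ n⌋` bits. [cite: LimayeSrinivasanTavenas2022, Def. 2] -/
theorem treeBiasGe_le {w : Fin d → ℤ} {Δ τ : ℕ} (hΔ : 1 ≤ Δ) (hd : 0 < d) (h : TreeBiasGe w Δ τ) :
    (τ : ℤ) ≤ ∑ j, |w j| - |∑ j, w j| :=
  (treeBiasGe_one_iff hd w τ).1 (treeBiasGe_anti_depth le_rfl hΔ h)

/-! ### Symmetric words collapse: the pair tree -/

/-- The **pair tree** of a matching `σ`: level `1` = the blocks `{i, σ i}` (labelled by `min i (σ i)`), a single
block from level `2` on. [folklore] -/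
def pairTree (σ : Fin d → Fin d) : LTree d where
  lab t i := if t = 0 then i else if t = 1 then min i (σ i) else ⟨0, lt_of_le_of_lt (Nat.zero_le _) i.isLt⟩
  leaf i := by simp
  refine t i j h := by
    rcases Nat.lt_or_ge t 1 with ht | ht
    · have ht0 : t = 0 := by omega
      subst ht0
      simp only [if_true] at h
      subst h
      rfl
    · have h1 : t + 1 ≠ 0 := by omega
      have h2 : t + 1 ≠ 1 := by omega
      simp only [h1, h2, if_false]

/-- An involution `σ` permutes each block of the pair tree at every level `≥ 1`. [folklore] -/
theorem pairTree_lab_apply (σ : Fin d → Fin d) (hσ : ∀ i, σ (σ i) = i) {t : ℕ} (ht : 1 ≤ t) (j : Fin d) :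
    (pairTree σ).lab t (σ j) = (pairTree σ).lab t j := by
  by_cases h1 : t = 1
  · subst h1
    simp only [pairTree, one_ne_zero, if_false, if_true, hσ j, min_comm]
  · have h0 : t ≠ 0 := by omega
    simp only [pairTree, h0, h1, if_false]

/-- For a **symmetric word** (`w (σ i) = -w i`, `σ` a fixed-point-free involution) every block of the pair tree at
a level `≥ 1` has sum `0` (pair the summands by `σ`). [folklore] -/
theorem blockSum_pairTree_eq_zero {w : Fin d → ℤ} (σ : Fin d → Fin d) (hσ : ∀ i, σ (σ i) = i)
    (hfix : ∀ i, σ i ≠ i) (hw : ∀ i, w (σ i) = -w i) {t : ℕ} (ht : 1 ≤ t) (l : Fin d) :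
    blockSum w (pairTree σ) t l = 0 := by
  unfold blockSum
  refine sum_involution (fun j _ => σ j) (fun j _ => by rw [hw j]; ring) (fun j _ _ => hfix j)
    (fun j hj => ?_) (fun j _ => hσ j)
  rw [mem_filter] at hj ⊢
  exact ⟨mem_univ _, by rw [pairTree_lab_apply σ hσ ht j]; exact hj.2⟩

/-- In the pair tree of a symmetric word every internal path has off-path cost `≤ 2|w_i|` (`i` = any leaf of
its end block): levels `≥ 2` see only zero block sums, level `1` sees the pair `{i, σ i}`. [folklore] -/
theorem offCost_pairTree_le {w : Fin d → ℤ} (σ : Fin d → Fin d) (hσ : ∀ i, σ (σ i) = i)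
    (hfix : ∀ i, σ i ≠ i) (hw : ∀ i, w (σ i) = -w i) (Δ : ℕ) {t : ℕ} (ht : 1 ≤ t) (i : Fin d) :
    offCost w (pairTree σ) Δ t i ≤ 2 * |w i| := by
  unfold offCost
  have hterm : ∀ u ∈ Icc t Δ, (∑ l ∈ (((univ.filter fun j => (pairTree σ).lab u j = (pairTree σ).lab u i).image
      ((pairTree σ).lab (u - 1))).filter fun l => u = t ∨ l ≠ (pairTree σ).lab (u - 1) i),
        |blockSum w (pairTree σ) (u - 1) l|) ≤ if u = 1 then 2 * |w i| else 0 := by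
    intro u hu
    rw [mem_Icc] at hu
    by_cases hu1 : u = 1
    · subst hu1
      rw [if_pos rfl]
      -- level 1: the end block is the pair {i, σ i}; its children are the two leaves
      have hsub : (((univ.filter fun j => (pairTree σ).lab 1 j = (pairTree σ).lab 1 i).image
          ((pairTree σ).lab (1 - 1))).filter fun l => 1 = t ∨ l ≠ (pairTree σ).lab (1 - 1) i) ⊆ {i, σ i} := by
        intro l hl
        rw [mem_filter, mem_image] at hl
        obtain ⟨⟨j, hj, hjl⟩, _⟩ := hl
        rw [mem_filter] at hj
        have h0 : (pairTree σ).lab (1 - 1) j = j := (pairTree σ).leaf j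
        rw [h0] at hjl
        subst hjl
        have hj1 : min j (σ j) = min i (σ i) := by
          simpa only [pairTree, one_ne_zero, if_false, if_true] using hj.2
        rw [mem_insert, mem_singleton]
        rcases min_choice j (σ j) with hm | hm <;> rcases min_choice i (σ i) with hm' | hm' <;>
          rw [hm, hm'] at hj1
        · exact Or.inl hj1
        · exact Or.inr hj1
        · right; rw [← hj1, hσ]
        · left; rw [← hσ j, hj1, hσ]
      calc _ ≤ ∑ l ∈ ({i, σ i} : Finset (Fin d)), |blockSum w (pairTree σ) (1 - 1) l| :=
            sum_le_sum_of_subset_of_nonneg hsub fun _ _ _ => abs_nonneg _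
        _ = |w i| + |w (σ i)| := by
            rw [sum_pair (hfix i).symm, show (1 - 1 : ℕ) = 0 from rfl, blockSum_zero, blockSum_zero]
        _ = 2 * |w i| := by rw [hw i, abs_neg]; ring
    · rw [if_neg hu1]
      refine le_of_eq (sum_eq_zero fun l _ => ?_)
      rw [blockSum_pairTree_eq_zero σ hσ hfix hw (by omega : 1 ≤ u - 1), abs_zero]
  calc _ ≤ ∑ u ∈ Icc t Δ, (if u = 1 then 2 * |w i| else 0) := sum_le_sum hterm
    _ ≤ 2 * |w i| := by
        rw [sum_ite_eq']
        split_ifs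
        · exact le_rfl
        · positivity

/-- **Symmetric words have no tree bias beyond one pair**: if `σ` is a fixed-point-free involution of the index
set with `w (σ i) = -w i` and `|w i| ≤ M`, then `Treebias_Δ(W) ≥ τ` forces `τ ≤ 2M` for every `Δ ≥ 2` (the
pair tree).  The explicit words of the ordered / non-commutative `IMM` lower bound (TLS 2022 eq. (5)) are
symmetric, so they certify nothing through `TreeBiasImmFormula`: «TLS words do not transfer».
[cite: LimayeSrinivasanTavenas2022, Def. 2] -/
theorem treeBiasGe_symm_le {w : Fin d → ℤ} (σ : Fin d → Fin d) (hσ : ∀ i, σ (σ i) = i) (hfix : ∀ i, σ i ≠ i)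
    (hw : ∀ i, w (σ i) = -w i) {M : ℤ} (hM : ∀ i, |w i| ≤ M) {Δ τ : ℕ} (hΔ : 2 ≤ Δ) (h : TreeBiasGe w Δ τ) :
    (τ : ℤ) ≤ 2 * M := by
  have hroot : ∀ i j, (pairTree σ).lab Δ i = (pairTree σ).lab Δ j := fun i j => by
    have h0 : Δ ≠ 0 := by omega
    have h1 : Δ ≠ 1 := by omega
    simp only [pairTree, h0, h1, if_false]
  obtain ⟨t, i, ht1, _, hτ⟩ := h (pairTree σ) hroot
  have h1 := offCost_pairTree_le σ hσ hfix hw Δ ht1 i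
  have h2 : 0 ≤ |∑ j, w j| := abs_nonneg _
  have h3 := hM i
  linarith

/-- The smallest instance: the two-letter word `(k, -k)` has `Treebias_Δ = 0`-range bias `≤ 2k` at every depth
`Δ ≥ 2` (compare `treeBiasGe_one_pair`: exactly `2k` at depth `1`). [folklore] -/
example (k : ℕ) {Δ τ : ℕ} (hΔ : 2 ≤ Δ) (h : TreeBiasGe (d := 2) ![(k : ℤ), -(k : ℤ)] Δ τ) : (τ : ℤ) ≤ 2 * k :=
  treeBiasGe_symm_le (w := ![(k : ℤ), -(k : ℤ)]) (fun i => i.rev) (fun i => Fin.rev_rev i)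
    (fun i => by fin_cases i <;> decide) (fun i => by fin_cases i <;> simp) (M := k)
    (fun i => by fin_cases i <;> simp) hΔ h

end Summit.ValiantsHypothesis.ValiantsHypothesis.Theorems.DepthWindow.TreeBias
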